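/-
Copyright (c) 2026 the pub-hodgecm-mathlib formalisation cell (harness21).  Prover seat hodgecm-mathlib-K2E4-p11 (g3), Track B ∕ K2-LIT, h413 =
`stmt-HodgeConjecture-24833`, campaign «EIS-RANK-ONE» rung R4 «EIS-R4-growth», road (A), file (A1); DEAL BY NAME of the dealer K2E1-plan (g3) 2026-09-04T05:21:25Z (ii).
-/
import Summits.HodgeConjecture.HodgeConjecture.Theorems.K2E1BorelEisensteinGodementU   -- ★ p857410: `exists_smear_borelHeight`, big cell ★ at `N = 3, 2`
import HarnessLib

/-!
# K2·E1 — `K2E1RationalPointsNearBorel` (rung R4 «moderate growth», road (A), file (A1)): RATIONAL POINTS NEAR A HIGH POINT ARE BOREL —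
# `G(F) ∩ g·D·g⁻¹ ⊆ B(F)` once `H(g)² > A_D`, and the multiplicity set of Godement's count injects into `B(F) ∩ b·D'·b⁻¹`

Track B ∕ K2-LIT, crux h413 = `stmt-HodgeConjecture-24833`, route of record `HCCMUnconditional`; cell `hodgecm-mathlib`, squad K2, ENGINE E1, campaign EIS-RANK-ONE
rung R4 (moderate growth of the Borel Eisenstein series on Siegel sets), road (A) «Godement's count» (dealer K2E1-plan (g3) 05:21:25Z; census K2E1-p08 (g4) 05:08:07Z,
K2E4-p14 (g5) 05:13:14Z).  Prover seat `hodgecm-mathlib-K2E4-p11` (g3).  THEOREMS ONLY (no `def`, no `instance`, no notation, no named-fact hypothesis, no `sorry`);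
lane `--kind proof --supports stmt-HodgeConjecture-24833 --as helper` (count-neutral, closes no socket).

THE ROAD.  ★ (G0) `K2E1GodementCount.tsum_le_mul_lintegral_weight` bounds `Σ'_q ψ₁(γ̃_q g) ≤ (A·m ∕ μC)·∫⁻ ψ₂ β'` with the MULTIPLICITY
`m = #(G(F) ∩ (g•C)·(g•C)⁻¹)` (★ `coveringSum_indicator_le_ncard`); the quantitative E4 `∫⁻ β' 𝟙{H ≤ C₀}H^τ = K·C₀^{τ−2ρ_H}` is ★ (p857604 (δ) + p857444 Tate).  Moderate
growth `Σ'_q H(γ̃_q g)^τ ≪ H(g)^τ` on a Siegel set therefore hinges on the GROWTH OF `m` in `g`: `m ≤ M·H(g)^{2ρ_H}` = `M·δ_B`.  This file (A1) does the SOFT half: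
* §1 **THE BIG-CELL CUT** (`N`-generic under the rank-one big cell `hSiegel : γ ∉ B(F) ⟹ H(γ g)·H(g) ≤ 1`, ★ `borelHeight_mul_borelHeight_le_one_of_not_mem_arithmeticBorel(_two)`):
  if `A` bounds the smear of a set `D` from below (`H(x) ≤ A·H(x d)`, `d ∈ D`; ★ `exists_smear_borelHeight` for compact `D`) and `A < H(g)²`, then every `γ ∈ G(F)`
  with `γ g ∈ g·D` lies in `B(F)` (`mem_arithmeticBorel_of_mul_eq_mul`): else `H(g)² ≤ A·H(γg)·H(g) ≤ A`.  Hence `G(F) ∩ (g•C)(g•C)⁻¹ ⊆ B(F)♯`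
  (`inter_smul_mul_inv_subset_arithmeticBorel`, with `D = C·C⁻¹`).
* §2 **TRANSPORT TO THE BOREL** (`g = b·k`, `k ∈ K`): `G(F) ∩ (g•C)(g•C)⁻¹ ⊆ B(F)♯ ∩ {x | ∃ d ∈ K·(C·C⁻¹)·K⁻¹, x·b = b·d}`
  (`inter_smul_mul_inv_subset_arithmeticBorel_inter_conj`) — the set file (A2) `K2E1BorelLatticeCount` counts (`≤ M·δ_B(b)` on the Siegel region: torus parts finite,
  unipotent parts a lattice count under the torus contraction), file (A3) `K2E1BorelEisensteinModerateGrowth` assembling.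
* §3 the `U(J₃)` ∕ `U(J₂)` instances (`hSiegel` discharged by ★).
[Godement1964, §8; MoeglinWaldspurger1995, I.2.4 and II.1.5 (moderate growth of Eisenstein series); Garrett2018, §1.8, §3.10–3.11; Borel1963, §5.]

HONEST LABEL: HC_CM is proved only modulo the 7 printed citations (2 remaining named inputs: hLiu418 = `stmt-HodgeConjecture-24832`, h413 = `stmt-HodgeConjecture-24833`) until
rung 0 closes; count-neutral helper, closes no socket.

## References
* [Godement1964] R. Godement, *Domaines fondamentaux des groupes arithmétiques*, Sém. Bourbaki 257 (1962∕63), §8.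
* [MoeglinWaldspurger1995] C. Mœglin, J.-L. Waldspurger, *Spectral Decomposition and Eisenstein Series* (1995), I.2.4, II.1.5.
* [Garrett2018] P. Garrett, *Modern Analysis of Automorphic Forms by Example* (2018), §1.8, §3.10–3.11.
* [Borel1963] A. Borel, *Some finiteness properties of adele groups over number fields*, Publ. Math. IHÉS 16 (1963), §5.
-/

set_option autoImplicit false
-- the mandated namespace repeats the single-problem summit's segment (`HodgeConjecture.HodgeConjecture`)
set_option linter.dupNamespace false

noncomputable section

open Set NumberField IsDedekindDomain
open scoped NNReal Pointwise
open Literature.NumberTheory.Automorphic Literature.NumberTheory.Automorphic.UnitaryGroup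
open Summit.HodgeConjecture.HodgeConjecture.Cruxes.H413.K2E1BorelEisensteinGodementU (exists_smear_borelHeight)

namespace Summit.HodgeConjecture.HodgeConjecture.Cruxes.H413.K2E1RationalPointsNearBorel

variable {F E : Type} [Field F] [NumberField F] [Field E] [NumberField E] [Algebra F E] {c : E ≃ₐ[F] E} {N : ℕ} [NeZero N]

/-! ## §1 The big-cell cut -/

/-- **THE BIG-CELL CUT.**  In `F`-rank one (`hSiegel`: `H(γ g)·H(g) ≤ 1` off `B(F)`), let `A` bound the smear of `D ⊆ G(𝔸)` from below — `H(x) ≤ A·H(x d)` for `d ∈ D` — and let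
`A < H(g)²`.  Then every rational `γ` with `γ g = g d`, `d ∈ D`, lies in `B(F)`: otherwise `H(g)² ≤ A·H(γ g)·H(g) ≤ A`.
[cite: MoeglinWaldspurger1995, I.2.4] [cite: Garrett2018, §3.10–3.11] [cite: Godement1964, §8] -/
theorem mem_arithmeticBorel_of_mul_eq_mul
    (hSiegel : ∀ γ : (quasiSplit F E c N).arithmeticSubgroup, γ ∉ arithmeticBorel F E c N →
      ∀ g : (quasiSplit F E c N).Adelic, borelHeight ((γ : (quasiSplit F E c N).Adelic) * g) * borelHeight g ≤ 1)
    {D : Set (quasiSplit F E c N).Adelic} {A : ℝ≥0}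
    (hA : ∀ x : (quasiSplit F E c N).Adelic, ∀ d ∈ D, borelHeight x ≤ A * borelHeight (x * d))
    {g : (quasiSplit F E c N).Adelic} (hg : A < borelHeight g * borelHeight g)
    {γ : (quasiSplit F E c N).arithmeticSubgroup} {d : (quasiSplit F E c N).Adelic} (hd : d ∈ D)
    (h : (γ : (quasiSplit F E c N).Adelic) * g = g * d) :
    γ ∈ arithmeticBorel F E c N := by
  by_contra hγ
  have h1 := hSiegel γ hγ g
  have h2 : borelHeight g ≤ A * borelHeight ((γ : (quasiSplit F E c N).Adelic) * g) := by rw [h]; exact hA g d hd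
  have h3 : borelHeight g * borelHeight g ≤ A :=
    calc borelHeight g * borelHeight g ≤ (A * borelHeight ((γ : (quasiSplit F E c N).Adelic) * g)) * borelHeight g := by gcongr
      _ = A * (borelHeight ((γ : (quasiSplit F E c N).Adelic) * g) * borelHeight g) := mul_assoc _ _ _
      _ ≤ A * 1 := by gcongr
      _ = A := mul_one _
  exact not_lt.2 h3 hg

omit [NeZero N] in
/-- Elements of `(g•C)·(g•C)⁻¹` are the `x` with `x g = g d`, `d ∈ C·C⁻¹`. [folklore] -/
theorem exists_mul_eq_mul_of_mem_smul_mul_inv {C : Set (quasiSplit F E c N).Adelic} {g x : (quasiSplit F E c N).Adelic}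
    (hx : x ∈ (g • C) * (g • C)⁻¹) : ∃ d ∈ C * C⁻¹, x * g = g * d := by
  obtain ⟨s₁, hs₁, s₂, hs₂, rfl⟩ := Set.mem_mul.1 hx
  obtain ⟨c₁, hc₁, rfl⟩ := Set.mem_smul_set.1 hs₁
  obtain ⟨c₂, hc₂, hc₂eq⟩ := Set.mem_smul_set.1 (Set.mem_inv.1 hs₂)
  refine ⟨c₁ * c₂⁻¹, Set.mul_mem_mul hc₁ (Set.inv_mem_inv.2 hc₂), ?_⟩
  have hs₂v : s₂ = (g * c₂)⁻¹ := by rw [← smul_eq_mul, hc₂eq, inv_inv]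
  rw [hs₂v, smul_eq_mul, mul_inv_rev]
  group

/-- **`G(F) ∩ (g•C)(g•C)⁻¹ ⊆ B(F)♯` for a high point**: with `A` a lower smear bound of `C·C⁻¹` and `A < H(g)²`, every rational element of the multiplicity set
`(g•C)·(g•C)⁻¹` of Godement's count lies in `B(F)♯ = (arithmeticBorel).map (arithmeticSubgroup).subtype`. [cite: MoeglinWaldspurger1995, I.2.4] [cite: Garrett2018, §1.8] -/
theorem inter_smul_mul_inv_subset_arithmeticBorel
    (hSiegel : ∀ γ : (quasiSplit F E c N).arithmeticSubgroup, γ ∉ arithmeticBorel F E c N →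
      ∀ g : (quasiSplit F E c N).Adelic, borelHeight ((γ : (quasiSplit F E c N).Adelic) * g) * borelHeight g ≤ 1)
    {C : Set (quasiSplit F E c N).Adelic} {A : ℝ≥0}
    (hA : ∀ x : (quasiSplit F E c N).Adelic, ∀ d ∈ C * C⁻¹, borelHeight x ≤ A * borelHeight (x * d))
    {g : (quasiSplit F E c N).Adelic} (hg : A < borelHeight g * borelHeight g) :
    ((quasiSplit F E c N).arithmeticSubgroup : Set (quasiSplit F E c N).Adelic) ∩ ((g • C) * (g • C)⁻¹) ⊆
      ((arithmeticBorel F E c N).map (quasiSplit F E c N).arithmeticSubgroup.subtype : Set (quasiSplit F E c N).Adelic) := by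
  rintro x ⟨hxΓ, hxS⟩
  obtain ⟨d, hd, hxd⟩ := exists_mul_eq_mul_of_mem_smul_mul_inv hxS
  have hγ := mem_arithmeticBorel_of_mul_eq_mul hSiegel hA hg (γ := ⟨x, hxΓ⟩) hd hxd
  exact ⟨⟨x, hxΓ⟩, hγ, rfl⟩

/-! ## §2 Transport to the Borel: `g = b·k` -/

/-- **THE MULTIPLICITY SET INJECTS INTO `B(F)♯ ∩ b·D'·b⁻¹`.**  Same hypotheses, and `g = b·k` with `b ∈ B(𝔸)`, `k ∈ K`: every rational element `x` of `(g•C)·(g•C)⁻¹` lies in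
`B(F)♯` and satisfies `x·b = b·d'` for some `d' ∈ K·(C·C⁻¹)·K⁻¹` — i.e. `G(F) ∩ (g•C)(g•C)⁻¹ ⊆ B(F)♯ ∩ b·D'·b⁻¹`, `D' = K(CC⁻¹)K⁻¹` (compact with `C`, `K`), the set counted by
file (A2). [cite: MoeglinWaldspurger1995, I.2.4] [cite: Garrett2018, §1.8] -/
theorem inter_smul_mul_inv_subset_arithmeticBorel_inter_conj
    (hSiegel : ∀ γ : (quasiSplit F E c N).arithmeticSubgroup, γ ∉ arithmeticBorel F E c N →
      ∀ g : (quasiSplit F E c N).Adelic, borelHeight ((γ : (quasiSplit F E c N).Adelic) * g) * borelHeight g ≤ 1)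
    {C K : Set (quasiSplit F E c N).Adelic} {A : ℝ≥0}
    (hA : ∀ x : (quasiSplit F E c N).Adelic, ∀ d ∈ C * C⁻¹, borelHeight x ≤ A * borelHeight (x * d))
    {g : (quasiSplit F E c N).Adelic} (hg : A < borelHeight g * borelHeight g)
    {b : borelAdelic F E c N} {k : (quasiSplit F E c N).Adelic} (hk : k ∈ K) (hgbk : g = (b : (quasiSplit F E c N).Adelic) * k) :
    ((quasiSplit F E c N).arithmeticSubgroup : Set (quasiSplit F E c N).Adelic) ∩ ((g • C) * (g • C)⁻¹) ⊆
      ((arithmeticBorel F E c N).map (quasiSplit F E c N).arithmeticSubgroup.subtype : Set (quasiSplit F E c N).Adelic) ∩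
        {x | ∃ d ∈ K * (C * C⁻¹) * K⁻¹, x * (b : (quasiSplit F E c N).Adelic) = (b : (quasiSplit F E c N).Adelic) * d} := by
  intro x hx
  refine ⟨inter_smul_mul_inv_subset_arithmeticBorel hSiegel hA hg hx, ?_⟩
  obtain ⟨d, hd, hxd⟩ := exists_mul_eq_mul_of_mem_smul_mul_inv hx.2
  refine ⟨k * d * k⁻¹, Set.mul_mem_mul (Set.mul_mem_mul hk hd) (Set.inv_mem_inv.2 hk), ?_⟩
  -- `x b = x g k⁻¹ = g d k⁻¹ = b (k d k⁻¹)`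
  have h1 : x * (b : (quasiSplit F E c N).Adelic) = x * g * k⁻¹ := by rw [hgbk, mul_assoc, mul_inv_cancel_right]
  rw [h1, hxd, hgbk]
  group

/-! ## §3 The instances `U(J₃)`, `U(J₂)` (big cell ★) with the smear constant of ★ `exists_smear_borelHeight` -/

/-- **`U(J₃)`**: for compact `C`, `K` and the Iwasawa decomposition `hIw` there is `A ≥ 1` (the smear constant of `C·C⁻¹`) such that for every `g = b·k` (`b ∈ B(𝔸)`, `k ∈ K`) with
`A < H(g)²`: `G(F) ∩ (g•C)(g•C)⁻¹ ⊆ B(F)♯ ∩ {x | ∃ d ∈ K(CC⁻¹)K⁻¹, x b = b d}`. [cite: MoeglinWaldspurger1995, I.2.4] [cite: Garrett2018, §3.10–3.11] -/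
theorem exists_smear_inter_smul_mul_inv_subset_three
    (hIw : ∀ g : (quasiSplit F E c 3).Adelic, ∃ b ∈ borelAdelic F E c 3, ∃ k : (quasiSplit F E c 3).Adelic,
      adelicVal F E c 3 ((StdForm.antidiagonal 3).over E) k ∈ standardMaximalCompactGL 3 E ∧ g = b * k)
    {C : Set (quasiSplit F E c 3).Adelic} (hC : IsCompact C) (K : Set (quasiSplit F E c 3).Adelic) :
    ∃ A : ℝ≥0, 1 ≤ A ∧ ∀ (g : (quasiSplit F E c 3).Adelic) (b : borelAdelic F E c 3) (k : (quasiSplit F E c 3).Adelic),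
      k ∈ K → g = (b : (quasiSplit F E c 3).Adelic) * k → A < borelHeight g * borelHeight g →
      ((quasiSplit F E c 3).arithmeticSubgroup : Set (quasiSplit F E c 3).Adelic) ∩ ((g • C) * (g • C)⁻¹) ⊆
        ((arithmeticBorel F E c 3).map (quasiSplit F E c 3).arithmeticSubgroup.subtype : Set (quasiSplit F E c 3).Adelic) ∩
          {x | ∃ d ∈ K * (C * C⁻¹) * K⁻¹, x * (b : (quasiSplit F E c 3).Adelic) = (b : (quasiSplit F E c 3).Adelic) * d} := by
  obtain ⟨A, hA1, hA⟩ := exists_smear_borelHeight hIw (hC.mul hC.inv)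
  exact ⟨A, hA1, fun g b k hk hgbk hg => inter_smul_mul_inv_subset_arithmeticBorel_inter_conj
    (fun γ hγ y => borelHeight_mul_borelHeight_le_one_of_not_mem_arithmeticBorel hγ y) (fun x d hd => (hA x d hd).2) hg hk hgbk⟩

/-- **`U(J₂)`**: the same with the `N = 2` big cell ★ `borelHeight_mul_borelHeight_le_one_of_not_mem_arithmeticBorel_two`. [cite: MoeglinWaldspurger1995, I.2.4] -/
theorem exists_smear_inter_smul_mul_inv_subset_two
    (hIw : ∀ g : (quasiSplit F E c 2).Adelic, ∃ b ∈ borelAdelic F E c 2, ∃ k : (quasiSplit F E c 2).Adelic,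
      adelicVal F E c 2 ((StdForm.antidiagonal 2).over E) k ∈ standardMaximalCompactGL 2 E ∧ g = b * k)
    {C : Set (quasiSplit F E c 2).Adelic} (hC : IsCompact C) (K : Set (quasiSplit F E c 2).Adelic) :
    ∃ A : ℝ≥0, 1 ≤ A ∧ ∀ (g : (quasiSplit F E c 2).Adelic) (b : borelAdelic F E c 2) (k : (quasiSplit F E c 2).Adelic),
      k ∈ K → g = (b : (quasiSplit F E c 2).Adelic) * k → A < borelHeight g * borelHeight g →
      ((quasiSplit F E c 2).arithmeticSubgroup : Set (quasiSplit F E c 2).Adelic) ∩ ((g • C) * (g • C)⁻¹) ⊆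
        ((arithmeticBorel F E c 2).map (quasiSplit F E c 2).arithmeticSubgroup.subtype : Set (quasiSplit F E c 2).Adelic) ∩
          {x | ∃ d ∈ K * (C * C⁻¹) * K⁻¹, x * (b : (quasiSplit F E c 2).Adelic) = (b : (quasiSplit F E c 2).Adelic) * d} := by
  obtain ⟨A, hA1, hA⟩ := exists_smear_borelHeight hIw (hC.mul hC.inv)
  exact ⟨A, hA1, fun g b k hk hgbk hg => inter_smul_mul_inv_subset_arithmeticBorel_inter_conj
    (fun γ hγ y => borelHeight_mul_borelHeight_le_one_of_not_mem_arithmeticBorel_two hγ y) (fun x d hd => (hA x d hd).2) hg hk hgbk⟩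

end Summit.HodgeConjecture.HodgeConjecture.Cruxes.H413.K2E1RationalPointsNearBorel

end
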